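import Mathlib
import Summits.Parity.GeneralizedHardyLittlewood.Theorems.FordMaynardSieveConst01651SieveConst01651HwtSplit

/-!
# Route `FordMaynardSieveConst01651`, target `SieveConst01651` (stmt-Parity-19185), line `sieve_decomposition`:
# helpers towards `stub_typeIIRegion` — `|G(d; n)| ≪_g 1` and `|H(n)| ≪_g τ(n)` for EVERY `n ≥ 2`

Ford–Maynard, Lemma 7.18 (b): `|H(n)| ≪ 1` when `P⁻(n) ≥ n^ν` (boundedly many divisors).  For the Type-II region
(Proposition 7.19) one also needs the trivial bound for ALL `n`: every `g`-value entering `G(d; n)` is taken at the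
log-vector of a rough part, which has `≤ 1/ν` entries, so `|G(d; n)| ≤ C(g, ν)` and `|H(n)| ≤ τ(n) · C(g, ν)` —
the shape that pairs with the growth condition (w) `∑ |w_n| τ(n) ≤ x (log x)^ϖ` and with the discards.
Here `Hwt`, `Gwt`, `pvec`, `roughPart` are the tree's (`…SieveConst01651Defs`, verbatim the skeleton's).

* `exists_bound_of_isPiecewiseConstOnCone` — `∃ C ≥ 0, ∀ k ≤ K, |g_k| ≤ C` on monotone vectors;
* `length_roughPart_le_of_le` — the rough part of any `d ≤ n`, `d ≥ 1`, has `≤ 1/ν` prime factors;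
* `abs_Gwt_le_of_bound`, `exists_abs_Gwt_le` — `|G(d; n)| ≤ C` for all `n ≥ 2`, all `d ≤ n`;
* `exists_abs_Hwt_le_card_divisors` — `|H(n)| ≤ C τ(n)` for all `n ≥ 2`.

Def-free. Nothing here proves anything about the Parity summit; helpers for the Type-II region stub of one leaf.
-/

open Finset Literature.NumberTheory.Sieve Literature.NumberTheory.Sieve.FordMaynard

namespace Summit.Parity.GeneralizedHardyLittlewood.FordMaynardSieveConst01651SieveConst01651

/-- `pvec n d` is monotone (the prime-factor list is sorted). [folklore] -/
theorem pvec_mono (n d : ℕ) : Monotone (pvec n d) := by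
  intro i j hij
  unfold pvec
  rcases lt_or_ge 1 n with hn | hn
  · have hlog : 0 < Real.log n := Real.log_pos (by exact_mod_cast hn)
    apply div_le_div_of_nonneg_right _ hlog.le
    have hi : 0 < d.primeFactorsList.get i := Nat.pos_of_mem_primeFactorsList (List.get_mem _ _)
    apply Real.log_le_log (by exact_mod_cast hi)
    exact_mod_cast Nat.primeFactorsList_sorted d hij
  · have : Real.log n = 0 := by
      interval_cases n <;> simp
    simp [this]

/-- **A piecewise-constant-on-the-cone `g` is bounded on monotone vectors, uniformly in dimensions `≤ K`.**
[cite: FordMaynard2024PrimeSieves, Definition 7.2 (boundedness of `g ∈ 𝒮𝒢₁`)] -/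
theorem exists_bound_of_isPiecewiseConstOnCone {g : VecFn} (hpc : IsPiecewiseConstOnCone g) (K : ℕ) :
    ∃ C : ℝ, 0 ≤ C ∧ ∀ k, k ≤ K → ∀ x : Fin k → ℝ, Monotone x → |g k x| ≤ C := by
  classical
  have hC : ∀ k, ∃ C : ℝ, 0 ≤ C ∧ ∀ x : Fin k → ℝ, Monotone x → |g k x| ≤ C := by
    intro k
    obtain ⟨m, P, c, -, hg⟩ := hpc k
    refine ⟨∑ j, |c j|, sum_nonneg fun j _ => abs_nonneg _, fun x hx => ?_⟩
    rw [hg x hx]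
    refine (abs_sum_le_sum_abs _ _).trans (sum_le_sum fun j _ => ?_)
    split_ifs <;> simp
  choose C hC0 hC using hC
  refine ⟨∑ k ∈ range (K + 1), C k, sum_nonneg fun k _ => hC0 k, fun k hk x hx => (hC k x hx).trans ?_⟩
  exact single_le_sum (f := C) (fun k _ => hC0 k) (mem_range.2 (Nat.lt_succ_of_le hk))

/-- **The rough part of `d` (`1 ≤ d ≤ n`) at `y = n^ν` has at most `1/ν` prime factors** (with multiplicity):
`y^{Ω} ≤ roughPart ≤ d ≤ n`. [cite: FordMaynard2024PrimeSieves, proof of Proposition 7.22 ("at most `1/σ` prime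
factors")] -/
theorem length_roughPart_le_of_le (ν : ℝ) {n d : ℕ} (hn : 2 ≤ n) (hd : d ≠ 0) (hdn : d ≤ n) :
    ((roughPart ((n : ℝ) ^ ν) d).primeFactorsList.length : ℝ) * ν ≤ 1 := by
  set y : ℝ := (n : ℝ) ^ ν with hy
  set m : ℕ := roughPart y d with hm
  have hn1 : (1 : ℝ) < n := by exact_mod_cast hn
  have hnpos : (0 : ℝ) < n := by positivity
  have hy0 : 0 ≤ y := Real.rpow_nonneg hnpos.le ν
  have hm0 : m ≠ 0 := (roughPart_ne_zero_and_dvd y d).1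
  have hmle : (m : ℝ) ≤ n := by
    have h1 : m ≤ d := Nat.le_of_dvd (Nat.pos_of_ne_zero hd) (roughPart_ne_zero_and_dvd y d).2
    exact_mod_cast h1.trans hdn
  have hfac : ∀ p ∈ m.primeFactorsList, y ≤ (p : ℝ) := fun p hp =>
    le_of_mem_primeFactors_roughPart (d := d) (Nat.mem_primeFactors_iff_mem_primeFactorsList.2 hp)
  have hpow : y ^ m.primeFactorsList.length ≤ (m : ℝ) := by
    have key : ∀ l : List ℕ, (∀ p ∈ l, y ≤ (p : ℝ)) → y ^ l.length ≤ ((l.prod : ℕ) : ℝ) := by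
      intro l
      induction l with
      | nil => intro _; simp
      | cons p l ih =>
          intro h
          rw [List.length_cons, pow_succ, List.prod_cons, Nat.cast_mul, mul_comm]
          exact mul_le_mul (h p (by simp)) (ih fun q hq => h q (by simp [hq])) (pow_nonneg hy0 _)
            (Nat.cast_nonneg _)
    have := key m.primeFactorsList hfac
    rwa [Nat.prod_primeFactorsList hm0] at this
  have hk : (n : ℝ) ^ (ν * m.primeFactorsList.length) ≤ (n : ℝ) ^ (1 : ℝ) := by
    rw [Real.rpow_mul hnpos.le, Real.rpow_natCast, Real.rpow_one]
    exact hpow.trans hmle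
  have := (Real.rpow_le_rpow_left_iff hn1).1 hk
  rw [mul_comm] at this
  exact this

/-- `|G(d; n)| ≤ C` whenever `|g_k| ≤ C` on monotone vectors of every dimension `k ≤ ⌊1/ν⌋` (`n ≥ 2`, `1 ≤ d ≤ n`,
`ν > 0`). [cite: FordMaynard2024PrimeSieves, Lemma 7.18 (b)] -/
theorem abs_Gwt_le_of_bound {ν : ℝ} (hν : 0 < ν) {g : VecFn} {C : ℝ} (hC0 : 0 ≤ C)
    (hC : ∀ k, k ≤ ⌊1 / ν⌋₊ → ∀ x : Fin k → ℝ, Monotone x → |g k x| ≤ C)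
    {n d : ℕ} (hn : 2 ≤ n) (hd : d ≠ 0) (hdn : d ≤ n) : |Gwt g ν n d| ≤ C := by
  unfold Gwt
  split_ifs with h
  · rw [abs_mul]
    have hlen : (roughPart ((n : ℝ) ^ ν) d).primeFactorsList.length ≤ ⌊1 / ν⌋₊ := by
      apply Nat.le_floor
      rw [le_div_iff₀ hν]
      exact length_roughPart_le_of_le ν hn hd hdn
    have hμ : |((ArithmeticFunction.moebius (smoothPart ((n : ℝ) ^ ν) d) : ℤ) : ℝ)| ≤ 1 := by
      rw [← Int.cast_abs]
      exact_mod_cast ArithmeticFunction.abs_moebius_le_one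
    calc _ ≤ 1 * C := mul_le_mul hμ (hC _ hlen _ (pvec_mono n _)) (abs_nonneg _) zero_le_one
      _ = C := one_mul C
  · simpa using hC0

/-- **`|G(d; n)| ≪_{g,ν} 1` for all `n ≥ 2` and all `1 ≤ d ≤ n`.** [cite: FordMaynard2024PrimeSieves, Lemma 7.18 (b)] -/
theorem exists_abs_Gwt_le {ν : ℝ} (hν : 0 < ν) {g : VecFn} (hpc : IsPiecewiseConstOnCone g) :
    ∃ C : ℝ, 0 ≤ C ∧ ∀ n d : ℕ, 2 ≤ n → d ≠ 0 → d ≤ n → |Gwt g ν n d| ≤ C := by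
  obtain ⟨C, hC0, hC⟩ := exists_bound_of_isPiecewiseConstOnCone hpc ⌊1 / ν⌋₊
  exact ⟨C, hC0, fun n d hn hd hdn => abs_Gwt_le_of_bound hν hC0 hC hn hd hdn⟩

/-- **`|H(n)| ≤ C · τ(n)` for every `n ≥ 2`** (all divisors `d ∣ n` have `1 ≤ d ≤ n`).
[cite: FordMaynard2024PrimeSieves, Lemma 7.18 (b) (and the trivial bound behind Proposition 7.19)] -/
theorem exists_abs_Hwt_le_card_divisors {ν : ℝ} (hν : 0 < ν) {g : VecFn} (hpc : IsPiecewiseConstOnCone g) :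
    ∃ C : ℝ, 0 ≤ C ∧ ∀ n : ℕ, 2 ≤ n → |Hwt g ν n| ≤ C * (n.divisors.card : ℝ) := by
  obtain ⟨C, hC0, hC⟩ := exists_abs_Gwt_le hν hpc
  refine ⟨C, hC0, fun n hn => ?_⟩
  unfold Hwt
  calc |∑ d ∈ n.divisors, Gwt g ν n d| ≤ ∑ d ∈ n.divisors, |Gwt g ν n d| := abs_sum_le_sum_abs _ _
    _ ≤ ∑ _d ∈ n.divisors, C := sum_le_sum fun d hd =>
        hC n d hn (Nat.pos_of_mem_divisors hd).ne' (Nat.divisor_le hd)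
    _ = C * (n.divisors.card : ℝ) := by rw [sum_const, nsmul_eq_mul, mul_comm]

/-! ### The cutoff `d ≤ n^{1/2}` of `G(d; n)` as an integer comparison -/

/-- `d ≤ n^{1/2}` (the real cutoff in `Gwt`) iff `d² ≤ n` in `ℕ`. [folklore] -/
theorem natCast_le_rpow_half_iff (d n : ℕ) : (d : ℝ) ≤ (n : ℝ) ^ (1 / 2 : ℝ) ↔ d * d ≤ n := by
  have hd : (0 : ℝ) ≤ d := Nat.cast_nonneg _
  have hn : (0 : ℝ) ≤ n := Nat.cast_nonneg _
  rw [← Real.sqrt_eq_rpow, Real.le_sqrt hd, sq]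
  · exact_mod_cast Iff.rfl
  · exact hn

/-- For `n = d e` (`d ≥ 1`): `d ≤ n^{1/2}` iff `d ≤ e` — Ford–Maynard's "`u ∏_{j∈𝒥} pⱼ ≤ n^γ`" at `γ = 1/2` is the
INTEGER comparison `d ≤ n/d` between the divisor and its cofactor (a gap condition: `BilinBoundedBy.threshold` /
`…BilinTools.bilin_threshold_nat_le'` with `g z = e / (d-part on the z side)` via `Nat.le_div_iff_mul_le`).
[cite: FordMaynard2024PrimeSieves, proof of Proposition 7.22 (the constraint `u ∏ pⱼ ≤ n^γ`)] -/
theorem natCast_le_rpow_half_iff_le_cofactor {d e : ℕ} (hd : 0 < d) :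
    (d : ℝ) ≤ ((d * e : ℕ) : ℝ) ^ (1 / 2 : ℝ) ↔ d ≤ e := by
  rw [natCast_le_rpow_half_iff]
  exact Nat.mul_le_mul_left_iff hd

/-- The product form used after peeling the Type-II variable: `a b ≤ c` iff `a ≤ c / b` (`b ≥ 1`), so a condition
`[m · g₁(t) ≤ g₂(t)]` coupling the short variable `m` with the tuple `t` is the integer threshold `[m ≤ g₂(t)/g₁(t)]`
of `…BilinTools.bilin_threshold_nat_le'`. [folklore] -/
theorem mul_le_iff_le_div {a b c : ℕ} (hb : 0 < b) : a * b ≤ c ↔ a ≤ c / b :=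
  (Nat.le_div_iff_mul_le hb).symm

end Summit.Parity.GeneralizedHardyLittlewood.FordMaynardSieveConst01651SieveConst01651
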